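import Literature.NumberTheory.DiophantineGeometry.ConductorExponentLeEightProofs
import Literature.NumberTheory.DiophantineGeometry.TameAdditiveTypesAtTwoProofs
import HarnessLib

/-!
# Kodaira type `Iₙ*` at `2`, exactly — part 1: `ord c₄` on the normal form and the two exits of the loop

Summit `BirchSwinnertonDyer`, route `ManinLocalTwoThree` (cell bsd-f2-manin), cruxes C2 `ManinOddAtFour`
(stmt-BirchSwinnertonDyer-22967) and C3 `ManinPrimeToThreeAtNine` (stmt-…-22968).  an's S-an-40′
`PotSupersingularComponentBoundTwo′` («pss at `2` ⟹ `m₂ ≤ 12`», MEMO-an §67.11, Sketch-an-g25b — the ONE census-only input of the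
clock law E-an-119 at `2`, «not located in print», ref1 §R71) is a statement about the `Iₙ*` branch of Tate's algorithm in residue
characteristic `2` (`m ≤ 12 ⟺` no potentially good `Iₙ*` with `n ≥ 8`).  This file and its sequel `…IstarTwoExact` prove the
EXACT local law behind it.

Let `R` be a DVR with perfect residue field in which `2` is a uniformiser (e.g. `ℤ₂`) and `V` a model at the start of round `m` of
the `Iₙ*` sub-procedure (Silverman ATAEC IV.9.4 Step 7: `2 ∣ a₁`, `2 ∥ a₂`, `2^{m+2} ∣ a₃`, `2^{m+3} ∣ a₄`, `2^{2m+4} ∣ a₆`).  Write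
`a₁ = 2α`.  This part proves:
* §1 `addVal_c₄_toNat_eq_four` / `…_eq_six` / `addVal_c₄_toNat_of_normalForm`: `ord c₄ = 4` if `α ∈ Rˣ` (`a₁ ∉ 𝔪²`), `ord c₄ = 6`
  if `2 ∣ α` (`a₁ ∈ 𝔪²`) — from `c₄ = b₂² − 24 b₄`; and `a₁_mem_sq_iff_of_smul`: the class of `a₁` mod `𝔪²` is preserved by every
  admissible translation of the loop (`u = 1`, `s ∈ 𝔪` by `OggBound.t_mem_sq_of_smul`, `a₁' = a₁ + 2s`).
* §2 the two exits EXACTLY (`addVal_Δ_toNat_of_istarA`: `n = 2m + 1` ⟹ `ord Δ = 8` (`m = 0`), `2m + 9` (`m ≥ 1`, `α ∈ Rˣ`), `12`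
  (`m = 1`, `2 ∣ α`), `2m + 11` (`m ≥ 2`, `2 ∣ α`); `addVal_Δ_toNat_of_istarB`: `n = 2m + 2` ⟹ `ord Δ = 2m + 10` (`α ∈ Rˣ`), `2m + 12`
  (`m ≥ 1`, `2 ∣ α`), `∈ {12, 13}` (`m = 0`, `2 ∣ α`)).  The polynomial identities are those of the tree's
  `…ConductorExponentLeEightProofs` (`addVal_Δ_toNat_le_of_istarA/B`, which keep only `ord Δ ≤ n + 11`); here the exact values are
  recorded, since `ord₂ j = 3·ord₂ c₄ − ord₂ Δ` decides potentially good / supersingular / ordinary on the `Iₙ*` branch.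

HONEST FRAMING: local structure theorems (Tate's algorithm, literally); C2, C3, Manin's conjecture and BSD are not proved.  No
definitions, no named facts, no sorry.  References: [SilvermanATAEC1994] IV.9.4 Step 7, Table 4.1; [Papadopoulos1993] Table IV
(p = 2), for comparison only.
-/

set_option linter.dupNamespace false
set_option autoImplicit false

noncomputable section

open scoped Classical

open Polynomial IsLocalRing
  Literature.NumberTheory.DiophantineGeometry Literature.NumberTheory.DiophantineGeometry.TateAlgorithm
  Literature.NumberTheory.DiophantineGeometry.TateAlgorithm.CharTwo
open IsDiscreteValuationRing hiding maximalIdeal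

namespace Summit.BirchSwinnertonDyer.BirchSwinnertonDyer.Theorems.ManinLocalTwoThree

namespace IstarCharTwo

variable {R : Type*} [CommRing R] [IsDomain R] [IsDiscreteValuationRing R]

/-! ### §1 `ord c₄` on the `Iₙ*` normal form (`2` a uniformiser) -/

/-- On a model `a₁ = 2α`, `a₂ = 2p`, `4 ∣ a₃`, `8 ∣ a₄` with `α ∈ Rˣ`: `ord c₄ = 4`
(`c₄ = 2⁴(α⁴ + 2(…))`). [cite: SilvermanATAEC1994, IV.9.4 Step 7] -/
theorem addVal_c₄_toNat_eq_four (h2 : Irreducible (2 : R)) (V : WeierstrassCurve R) {α p γ q : R}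
    (ha₁ : V.a₁ = 2 * α) (hα : IsUnit α) (ha₂ : V.a₂ = 2 * p) (ha₃ : V.a₃ = 2 ^ 2 * γ) (ha₄ : V.a₄ = 2 ^ 3 * q) :
    (addVal R V.c₄).toNat = 4 := by
  have e : V.c₄ = 2 ^ 4 * (α ^ 4 + 2 * (2 * α ^ 2 * p + 2 * p ^ 2 - 6 * α * γ - 12 * q)) := by
    simp only [WeierstrassCurve.c₄, WeierstrassCurve.b₂, WeierstrassCurve.b₄, ha₁, ha₂, ha₃, ha₄]
    ring
  exact addVal_toNat_eq_of_two h2 (hα.pow 4) e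

/-- On a model `a₁ = 4α₁`, `a₂ = 2p` (`p ∈ Rˣ`), `4 ∣ a₃`, `8 ∣ a₄`: `ord c₄ = 6` (`c₄ = 2⁶(p² + 2(…))`).
[cite: SilvermanATAEC1994, IV.9.4 Step 7] -/
theorem addVal_c₄_toNat_eq_six (h2 : Irreducible (2 : R)) (V : WeierstrassCurve R) {α₁ p γ q : R}
    (ha₁ : V.a₁ = 2 * (2 * α₁)) (ha₂ : V.a₂ = 2 * p) (hp : IsUnit p) (ha₃ : V.a₃ = 2 ^ 2 * γ) (ha₄ : V.a₄ = 2 ^ 3 * q) :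
    (addVal R V.c₄).toNat = 6 := by
  have e : V.c₄ = 2 ^ 6 * (p ^ 2 + 2 * (2 * α₁ ^ 2 * p + 2 * α₁ ^ 4 - 3 * α₁ * γ - 3 * q)) := by
    simp only [WeierstrassCurve.c₄, WeierstrassCurve.b₂, WeierstrassCurve.b₄, ha₁, ha₂, ha₃, ha₄]
    ring
  exact addVal_toNat_eq_of_two h2 (hp.pow 2) e

/-- `ord c₄ ∈ {4, 6}` on the round-`m` normal form, according as `a₁ ∉ 𝔪²` or `a₁ ∈ 𝔪²`. [cite: SilvermanATAEC1994, IV.9.4 Step 7] -/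
theorem addVal_c₄_toNat_of_normalForm (h2 : Irreducible (2 : R)) (V : WeierstrassCurve R) {m : ℕ}
    (h1 : V.a₁ ∈ maximalIdeal R) (h2' : V.a₂ ∈ maximalIdeal R) (h2n : V.a₂ ∉ maximalIdeal R ^ 2)
    (h3 : V.a₃ ∈ maximalIdeal R ^ (m + 2)) (h4 : V.a₄ ∈ maximalIdeal R ^ (m + 3)) :
    (V.a₁ ∉ maximalIdeal R ^ 2 → (addVal R V.c₄).toNat = 4) ∧ (V.a₁ ∈ maximalIdeal R ^ 2 → (addVal R V.c₄).toNat = 6) := by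
  have h2m : ∀ {x : R} {n : ℕ}, x ∈ maximalIdeal R ^ n ↔ (2 : R) ^ n ∣ x := fun {x n} =>
    mem_maximalIdeal_pow_iff_dvd_of_irreducible h2 x n
  have h2m₁ : ∀ {x : R}, x ∈ maximalIdeal R ↔ (2 : R) ∣ x := fun {x} =>
    mem_maximalIdeal_iff_dvd_of_irreducible h2 x
  obtain ⟨α, hα⟩ := h2m₁.mp h1
  obtain ⟨p, hp⟩ := h2m₁.mp h2'
  have hpu : IsUnit p := by
    rw [isUnit_iff_not_dvd h2]
    rintro ⟨p', hp'⟩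
    exact h2n (h2m.mpr ⟨p', by rw [hp, hp']; ring⟩)
  obtain ⟨γ', hγ'⟩ := h2m.mp h3
  obtain ⟨q', hq'⟩ := h2m.mp h4
  have ha₃ : V.a₃ = 2 ^ 2 * (2 ^ m * γ') := by rw [hγ']; ring
  have ha₄ : V.a₄ = 2 ^ 3 * (2 ^ m * q') := by rw [hq']; ring
  constructor
  · intro hn
    have hαu : IsUnit α := by
      rw [isUnit_iff_not_dvd h2]
      rintro ⟨α', hα'⟩
      exact hn (h2m.mpr ⟨α', by rw [hα, hα']; ring⟩)
    exact addVal_c₄_toNat_eq_four h2 V hα hαu hp ha₃ ha₄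
  · intro hy
    obtain ⟨α₁, hα₁⟩ := h2m.mp hy
    exact addVal_c₄_toNat_eq_six h2 V (by rw [hα₁]; ring) hp hpu ha₃ ha₄

/-- `a₁ ∈ 𝔪²` is preserved by every admissible translation of the loop (`u = 1`, `r, s ∈ 𝔪`: `a₁' = a₁ + 2s`).
[cite: SilvermanATAEC1994, IV.9.4 Step 7] -/
theorem a₁_mem_sq_iff_of_smul (h2 : Irreducible (2 : R)) {V : WeierstrassCurve R} {D : WeierstrassCurve.VariableChange R}
    (hu : D.u = 1) (h1 : V.a₁ ∈ maximalIdeal R) (h2' : V.a₂ ∈ maximalIdeal R)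
    (h3 : V.a₃ ∈ maximalIdeal R ^ 2) (h4 : V.a₄ ∈ maximalIdeal R ^ 2) (h6 : V.a₆ ∈ maximalIdeal R ^ 3)
    (h1' : (D • V).a₁ ∈ maximalIdeal R) (h2'' : (D • V).a₂ ∈ maximalIdeal R)
    (h3' : (D • V).a₃ ∈ maximalIdeal R ^ 2) (h4' : (D • V).a₄ ∈ maximalIdeal R ^ 2) (h6' : (D • V).a₆ ∈ maximalIdeal R ^ 3) :
    (D • V).a₁ ∈ maximalIdeal R ^ 2 ↔ V.a₁ ∈ maximalIdeal R ^ 2 := by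
  obtain ⟨-, hs, -⟩ := OggBound.t_mem_sq_of_smul hu h1 h2' h3 h4 h6 h1' h2'' h3' h4' h6'
  have h2mem : (2 : R) ∈ maximalIdeal R := (mem_maximalIdeal _).mpr h2.not_isUnit
  have hd : 2 * D.s ∈ maximalIdeal R ^ 2 := by rw [pow_two]; exact Ideal.mul_mem_mul h2mem hs
  rw [smul_a₁_of_u_eq_one hu]
  constructor
  · intro h; simpa using sub_mem h hd
  · intro h; exact add_mem h hd


/-! ### §2 The exits of the `Iₙ*` loop, exactly, and the loop -/

/-- **Exit `n = 2m + 1`** (`Y² + a₃,ₘ₊₂Y − a₆,₂ₘ₊₄` has distinct roots, i.e. `a₃ = 2^{m+2}γ`, `γ ∈ Rˣ`): with `a₁ = 2α`,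
`ord Δ = 8` if `m = 0`; `ord Δ = 2m + 9` if `m ≥ 1`, `α ∈ Rˣ`; `ord Δ = 12` if `m = 1`, `2 ∣ α`; `ord Δ = 2m + 11` if `m ≥ 2`, `2 ∣ α`
(the identities of the tree's `addVal_Δ_toNat_le_of_istarA`, kept exact). [cite: SilvermanATAEC1994, IV.9.4 Step 7] -/
theorem addVal_Δ_toNat_of_istarA (h2 : Irreducible (2 : R)) (V : WeierstrassCurve R) (m : ℕ)
    (ha₁ : 2 ∣ V.a₁) {p : R} (ha₂ : V.a₂ = 2 * p) (hp : IsUnit p) {γ : R}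
    (ha₃ : V.a₃ = 2 ^ (m + 2) * γ) (hγ : IsUnit γ) (ha₄ : 2 ^ (m + 3) ∣ V.a₄)
    (ha₆ : 2 ^ (2 * m + 4) ∣ V.a₆) :
    (m = 0 → (addVal R V.Δ).toNat = 8) ∧
    (¬ 2 ^ 2 ∣ V.a₁ → 1 ≤ m → (addVal R V.Δ).toNat = 2 * m + 9) ∧
    (2 ^ 2 ∣ V.a₁ → (m = 1 → (addVal R V.Δ).toNat = 12) ∧ (2 ≤ m → (addVal R V.Δ).toNat = 2 * m + 11)) := by
  obtain ⟨α, hα⟩ := ha₁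
  obtain ⟨q, hq⟩ := ha₄
  obtain ⟨r, hr⟩ := ha₆
  refine ⟨?_, ?_, ?_⟩
  · rintro rfl
    have e : V.Δ = 2 ^ 8 * (γ ^ 4 + 2 *
        (-2 * α ^ 6 * r + 2 * α ^ 5 * γ * q - α ^ 4 * p * γ ^ 2 - 12 * α ^ 4 * p * r
       + 2 * α ^ 4 * q ^ 2 + 8 * α ^ 3 * p * γ * q + α ^ 3 * γ ^ 3 + 36 * α ^ 3 * γ * r
       - 4 * α ^ 2 * p ^ 2 * γ ^ 2 - 24 * α ^ 2 * p ^ 2 * r + 8 * α ^ 2 * p * q ^ 2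
       - 30 * α ^ 2 * γ ^ 2 * q + 72 * α ^ 2 * q * r + 8 * α * p ^ 2 * γ * q
       + 18 * α * p * γ ^ 3 + 72 * α * p * γ * r - 96 * α * γ * q ^ 2 - 4 * p ^ 3 * γ ^ 2
       - 16 * p ^ 3 * r + 8 * p ^ 2 * q ^ 2 + 36 * p * γ ^ 2 * q + 144 * p * q * r
       - 14 * γ ^ 4 - 108 * γ ^ 2 * r - 64 * q ^ 3 - 216 * r ^ 2)) := by
      simp only [WeierstrassCurve.Δ, WeierstrassCurve.b₂, WeierstrassCurve.b₄,
        WeierstrassCurve.b₆, WeierstrassCurve.b₈, hα, ha₂, ha₃, hq, hr]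
      ring
    exact addVal_toNat_eq_of_two h2 (hγ.pow 4) e
  · intro h4 hm
    have hαu : IsUnit α := by
      rw [isUnit_iff_not_dvd h2]
      rintro ⟨α', hα'⟩
      exact h4 ⟨α', by rw [hα, hα']; ring⟩
    obtain ⟨k, rfl⟩ : ∃ k, m = k + 1 := ⟨m - 1, by omega⟩
    have e : V.Δ = 2 ^ (2 * k + 11) * (α ^ 4 * p * γ ^ 2 + 2 *
        (-α ^ 6 * r + α ^ 5 * γ * q - α ^ 4 * p * γ ^ 2 - 6 * α ^ 4 * p * r + α ^ 4 * q ^ 2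
       + 4 * α ^ 3 * p * γ * q + α ^ 3 * γ ^ 3 * (2 ^ k : R)
       + 36 * α ^ 3 * γ * r * (2 ^ k : R) - 2 * α ^ 2 * p ^ 2 * γ ^ 2
       - 12 * α ^ 2 * p ^ 2 * r + 4 * α ^ 2 * p * q ^ 2
       - 30 * α ^ 2 * γ ^ 2 * q * (2 ^ k : R) + 72 * α ^ 2 * q * r * (2 ^ k : R)
       + 4 * α * p ^ 2 * γ * q + 18 * α * p * γ ^ 3 * (2 ^ k : R)
       + 72 * α * p * γ * r * (2 ^ k : R) - 96 * α * γ * q ^ 2 * (2 ^ k : R)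
       - 2 * p ^ 3 * γ ^ 2 - 8 * p ^ 3 * r + 4 * p ^ 2 * q ^ 2
       + 36 * p * γ ^ 2 * q * (2 ^ k : R) + 144 * p * q * r * (2 ^ k : R)
       - 27 * γ ^ 4 * (2 ^ k : R) ^ 2 - 216 * γ ^ 2 * r * (2 ^ k : R) ^ 2
       - 64 * q ^ 3 * (2 ^ k : R) - 432 * r ^ 2 * (2 ^ k : R) ^ 2)) := by
      simp only [WeierstrassCurve.Δ, WeierstrassCurve.b₂, WeierstrassCurve.b₄,
        WeierstrassCurve.b₆, WeierstrassCurve.b₈, hα, ha₂, ha₃, hq, hr]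
      ring
    rw [addVal_toNat_eq_of_two h2 (((hαu.pow 4).mul hp).mul (hγ.pow 2)) e]
    omega
  · rintro ⟨α', hα'⟩
    have hα₁ : α = 2 * α' := by
      have h22 : (2 : R) ≠ 0 := h2.ne_zero
      have : 2 * α = 2 * (2 * α') := by rw [← hα, hα']; ring
      exact mul_left_cancel₀ h22 this
    set α₁ := α' with hα₁def
    refine ⟨?_, ?_⟩
    · rintro rfl
      have e : V.Δ = 2 ^ 12 * (γ ^ 4 + 2 *
          (-p ^ 3 * γ ^ 2 - 4 * p ^ 3 * r - 4 * p ^ 2 * γ ^ 2 * α₁ ^ 2 + 4 * p ^ 2 * γ * q * α₁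
         + 2 * p ^ 2 * q ^ 2 - 24 * p ^ 2 * r * α₁ ^ 2 + 18 * p * γ ^ 3 * α₁
         + 18 * p * γ ^ 2 * q - 4 * p * γ ^ 2 * α₁ ^ 4 + 16 * p * γ * q * α₁ ^ 3
         + 72 * p * γ * r * α₁ + 8 * p * q ^ 2 * α₁ ^ 2 + 72 * p * q * r - 48 * p * r * α₁ ^ 4
         - 14 * γ ^ 4 + 4 * γ ^ 3 * α₁ ^ 3 - 60 * γ ^ 2 * q * α₁ ^ 2 - 108 * γ ^ 2 * r
         - 96 * γ * q ^ 2 * α₁ + 16 * γ * q * α₁ ^ 5 + 144 * γ * r * α₁ ^ 3 - 32 * q ^ 3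
         + 8 * q ^ 2 * α₁ ^ 4 + 144 * q * r * α₁ ^ 2 - 216 * r ^ 2 - 32 * r * α₁ ^ 6)) := by
        simp only [WeierstrassCurve.Δ, WeierstrassCurve.b₂, WeierstrassCurve.b₄,
          WeierstrassCurve.b₆, WeierstrassCurve.b₈, hα, ha₂, ha₃, hq, hr, hα₁]
        ring
      exact addVal_toNat_eq_of_two h2 (hγ.pow 4) e
    · intro hm
      obtain ⟨k, rfl⟩ : ∃ k, m = k + 2 := ⟨m - 2, by omega⟩
      have e : V.Δ = 2 ^ (2 * k + 15) * (p ^ 3 * γ ^ 2 + 2 *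
          (-p ^ 3 * γ ^ 2 - 2 * p ^ 3 * r - 2 * p ^ 2 * γ ^ 2 * α₁ ^ 2 + 2 * p ^ 2 * γ * q * α₁
         + p ^ 2 * q ^ 2 - 12 * p ^ 2 * r * α₁ ^ 2 + 18 * p * γ ^ 3 * (2 ^ k : R) * α₁
         + 18 * p * γ ^ 2 * q * (2 ^ k : R) - 2 * p * γ ^ 2 * α₁ ^ 4 + 8 * p * γ * q * α₁ ^ 3
         + 72 * p * γ * r * (2 ^ k : R) * α₁ + 4 * p * q ^ 2 * α₁ ^ 2
         + 72 * p * q * r * (2 ^ k : R) - 24 * p * r * α₁ ^ 4 - 27 * γ ^ 4 * (2 ^ k : R) ^ 2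
         + 4 * γ ^ 3 * (2 ^ k : R) * α₁ ^ 3 - 60 * γ ^ 2 * q * (2 ^ k : R) * α₁ ^ 2
         - 216 * γ ^ 2 * r * (2 ^ k : R) ^ 2 - 96 * γ * q ^ 2 * (2 ^ k : R) * α₁
         + 8 * γ * q * α₁ ^ 5 + 144 * γ * r * (2 ^ k : R) * α₁ ^ 3 - 32 * q ^ 3 * (2 ^ k : R)
         + 4 * q ^ 2 * α₁ ^ 4 + 144 * q * r * (2 ^ k : R) * α₁ ^ 2
         - 432 * r ^ 2 * (2 ^ k : R) ^ 2 - 16 * r * α₁ ^ 6)) := by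
        simp only [WeierstrassCurve.Δ, WeierstrassCurve.b₂, WeierstrassCurve.b₄,
          WeierstrassCurve.b₆, WeierstrassCurve.b₈, hα, ha₂, ha₃, hq, hr, hα₁]
        ring
      rw [addVal_toNat_eq_of_two h2 ((hp.pow 3).mul (hγ.pow 2)) e]
      omega

/-- **Exit `n = 2m + 2`** (after the `y`-translation, `a₂,₁X² + a₄,ₘ₊₃X + a₆,₂ₘ₊₅` has distinct roots, i.e. `a₄ = 2^{m+3}q`,
`q ∈ Rˣ`): `ord Δ = 2m + 10` if `α ∈ Rˣ`; `ord Δ = 2m + 12` if `2 ∣ α`, `m ≥ 1`; `12 ≤ ord Δ ≤ 13` if `2 ∣ α`, `m = 0` (the tree's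
`addVal_Δ_toNat_le_of_istarB` for the upper bound). [cite: SilvermanATAEC1994, IV.9.4 Step 7] -/
theorem addVal_Δ_toNat_of_istarB [PerfectField (ResidueField R)] (h2 : Irreducible (2 : R)) (V : WeierstrassCurve R) (m : ℕ)
    (ha₁ : 2 ∣ V.a₁) {p : R} (ha₂ : V.a₂ = 2 * p) (hp : IsUnit p)
    (ha₃ : 2 ^ (m + 3) ∣ V.a₃) {q : R} (ha₄ : V.a₄ = 2 ^ (m + 3) * q) (hq : IsUnit q)
    (ha₆ : 2 ^ (2 * m + 5) ∣ V.a₆) (hΔ0 : V.Δ ≠ 0) :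
    (¬ 2 ^ 2 ∣ V.a₁ → (addVal R V.Δ).toNat = 2 * m + 10) ∧
    (2 ^ 2 ∣ V.a₁ → (m = 0 → 12 ≤ (addVal R V.Δ).toNat ∧ (addVal R V.Δ).toNat ≤ 13) ∧
      (1 ≤ m → (addVal R V.Δ).toNat = 2 * m + 12)) := by
  have hle := addVal_Δ_toNat_le_of_istarB h2 V m ha₁ ha₂ hp ha₃ ha₄ hq ha₆
  obtain ⟨α, hα⟩ := ha₁
  obtain ⟨γ, hγ⟩ := ha₃
  obtain ⟨r, hr⟩ := ha₆
  refine ⟨?_, ?_⟩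
  · intro h4
    have hαu : IsUnit α := by
      rw [isUnit_iff_not_dvd h2]
      rintro ⟨α', hα'⟩
      exact h4 ⟨α', by rw [hα, hα']; ring⟩
    have e : V.Δ = 2 ^ (2 * m + 10) * (α ^ 4 * q ^ 2 + 2 *
        (-α ^ 6 * r + α ^ 5 * γ * q - α ^ 4 * p * γ ^ 2 - 6 * α ^ 4 * p * r
       + 4 * α ^ 3 * p * γ * q + 2 * α ^ 3 * γ ^ 3 * (2 ^ m : R)
       + 36 * α ^ 3 * γ * r * (2 ^ m : R) - 4 * α ^ 2 * p ^ 2 * γ ^ 2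
       - 12 * α ^ 2 * p ^ 2 * r + 2 * α ^ 2 * p * q ^ 2
       - 30 * α ^ 2 * γ ^ 2 * q * (2 ^ m : R) + 36 * α ^ 2 * q * r * (2 ^ m : R)
       + 4 * α * p ^ 2 * γ * q + 36 * α * p * γ ^ 3 * (2 ^ m : R)
       + 72 * α * p * γ * r * (2 ^ m : R) - 48 * α * γ * q ^ 2 * (2 ^ m : R)
       - 4 * p ^ 3 * γ ^ 2 - 8 * p ^ 3 * r + 2 * p ^ 2 * q ^ 2
       + 36 * p * γ ^ 2 * q * (2 ^ m : R) + 72 * p * q * r * (2 ^ m : R)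
       - 54 * γ ^ 4 * (2 ^ m : R) ^ 2 - 216 * γ ^ 2 * r * (2 ^ m : R) ^ 2
       - 16 * q ^ 3 * (2 ^ m : R) - 216 * r ^ 2 * (2 ^ m : R) ^ 2)) := by
      simp only [WeierstrassCurve.Δ, WeierstrassCurve.b₂, WeierstrassCurve.b₄,
        WeierstrassCurve.b₆, WeierstrassCurve.b₈, hα, ha₂, hγ, ha₄, hr]
      ring
    exact addVal_toNat_eq_of_two h2 ((hαu.pow 4).mul (hq.pow 2)) e
  · rintro ⟨α', hα'⟩
    have hα₁ : α = 2 * α' := by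
      have h22 : (2 : R) ≠ 0 := h2.ne_zero
      have : 2 * α = 2 * (2 * α') := by rw [← hα, hα']; ring
      exact mul_left_cancel₀ h22 this
    set α₁ := α' with hα₁def
    refine ⟨?_, ?_⟩
    · rintro rfl
      refine ⟨?_, by simpa using hle⟩
      -- `2¹² ∣ Δ` on the model `a₁ ∈ 𝔪²`, `a₂ ∈ 𝔪`, `a₃ ∈ 𝔪³`, `a₄ ∈ 𝔪³`, `a₆ ∈ 𝔪⁵` (`2 ∈ 𝔪`)
      have h2mem : (2 : R) ∈ maximalIdeal R := (mem_maximalIdeal _).mpr h2.not_isUnit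
      have h2m : ∀ {x : R} {n : ℕ}, (2 : R) ^ n ∣ x → x ∈ maximalIdeal R ^ n := fun {x n} h =>
        (mem_maximalIdeal_pow_iff_dvd_of_irreducible h2 x n).mpr h
      have h1 : V.a₁ ∈ maximalIdeal R ^ 2 := h2m ⟨α₁, by rw [hα, hα₁]; ring⟩
      have h2' : V.a₂ ∈ maximalIdeal R ^ 1 := h2m ⟨p, by rw [ha₂, pow_one]⟩
      have h3 : V.a₃ ∈ maximalIdeal R ^ 3 := h2m ⟨γ, by rw [hγ]⟩
      have h4 : V.a₄ ∈ maximalIdeal R ^ 3 := h2m ⟨q, by rw [ha₄]⟩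
      have h6 : V.a₆ ∈ maximalIdeal R ^ 5 := h2m ⟨r, by rw [hr]⟩
      have hmem : V.Δ ∈ maximalIdeal R ^ 12 :=
        Δ_mem_pow_of_a_of_two_mem V h2mem 3 4 6 6 h1 h2' h3 h4 h6
      exact le_addVal_toNat_of_pow_dvd h2 hΔ0 ((mem_maximalIdeal_pow_iff_dvd_of_irreducible h2 _ _).mp hmem)
    · intro hm
      obtain ⟨k, rfl⟩ : ∃ k, m = k + 1 := ⟨m - 1, by omega⟩
      have e : V.Δ = 2 ^ (2 * k + 14) * ((p * q) ^ 2 + 2 *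
          (-p ^ 3 * γ ^ 2 - 2 * p ^ 3 * r - 4 * p ^ 2 * γ ^ 2 * α₁ ^ 2 + 2 * p ^ 2 * γ * q * α₁
         - 12 * p ^ 2 * r * α₁ ^ 2 + 36 * p * γ ^ 3 * (2 ^ k : R) * α₁
         + 18 * p * γ ^ 2 * q * (2 ^ k : R) - 4 * p * γ ^ 2 * α₁ ^ 4 + 8 * p * γ * q * α₁ ^ 3
         + 72 * p * γ * r * (2 ^ k : R) * α₁ + 2 * p * q ^ 2 * α₁ ^ 2
         + 36 * p * q * r * (2 ^ k : R) - 24 * p * r * α₁ ^ 4 - 54 * γ ^ 4 * (2 ^ k : R) ^ 2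
         + 8 * γ ^ 3 * (2 ^ k : R) * α₁ ^ 3 - 60 * γ ^ 2 * q * (2 ^ k : R) * α₁ ^ 2
         - 216 * γ ^ 2 * r * (2 ^ k : R) ^ 2 - 48 * γ * q ^ 2 * (2 ^ k : R) * α₁
         + 8 * γ * q * α₁ ^ 5 + 144 * γ * r * (2 ^ k : R) * α₁ ^ 3 - 8 * q ^ 3 * (2 ^ k : R)
         + 2 * q ^ 2 * α₁ ^ 4 + 72 * q * r * (2 ^ k : R) * α₁ ^ 2
         - 216 * r ^ 2 * (2 ^ k : R) ^ 2 - 16 * r * α₁ ^ 6)) := by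
        simp only [WeierstrassCurve.Δ, WeierstrassCurve.b₂, WeierstrassCurve.b₄,
          WeierstrassCurve.b₆, WeierstrassCurve.b₈, hα, ha₂, hγ, ha₄, hr, hα₁]
        ring
      rw [addVal_toNat_eq_of_two h2 ((hp.mul hq).pow 2) e]
      omega


end IstarCharTwo

end Summit.BirchSwinnertonDyer.BirchSwinnertonDyer.Theorems.ManinLocalTwoThree

end
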